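import Mathlib
import HarnessLib

/-!
# Route `GenusKolyvaginAtTwo`, crux L_T `PowDvdShaCardAtTwoRT` (stmt-BirchSwinnertonDyer-23242), LINE 18 stub 3a⁗ —
# eigenclasses at `p = 2` are (co)norms: the `ℤ/2^M[C₂]`-module algebra behind the lost-bit law (part 1 of 2)

LEAD seat `bsd-line-gk2-p1` g15 (cell `bsd-f1-sign2`), `--supports stmt-BirchSwinnertonDyer-23242` (helper). Mathlib-only
algebra; THEOREMS ONLY (no definition, no named fact, no `sorry`). BSD is not proved by this file; neither is the crux.

At a Kolyvagin prime `λ ∣ ℓ` of `K` (level `≥ M`) the local groups `E(K_λ)/2^M ≅ H¹_ur(K_λ, E[2^M])` and `H¹(K_λ, E)[2^M] ≅ H¹_tr`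
are both `E[2^M]` in Frobenius coordinates (McCallum Prop. 4.4, Milne ADT I §2), `Frob_ℓ = τ` acts on `E[2^M]` and INVERTS
`μ_{2^M}` (`ℓ ≡ −1 mod 2^M`), so every Galois-equivariant pairing `B` is `τ`-ANTI-invariant: `B(τx, τy) = −B(x, y)`. On `Δ(E) < 0`
the route's PROVED item Q1 `CyclicTorsionOfNegDisc` makes `E[2^M] = ℤP₀ ⊕ ℤτP₀` FREE of rank one over `R_M = ℤ/2^M[C₂]` — the
substitute for the `±`-eigenspaces, which do not split at `2`. This file: §1 for an anti-invariant `B`, norms `p + τp` pair to `0`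
with norms, conorms `p − τp` with conorms, and `B(p + τp, q − τq) = 2·(B(p,q) − B(p,τq))` (ONE LOST BIT); §2 in a free rank-one
`R_M`-module the `τ`-fixed vectors are exactly the multiples of the norm `P₀ + τP₀` and the anti-fixed ones of the conorm `P₀ − τP₀`
(`H¹(C₂, R_M) = 0`), both of full order `2^M`; order bookkeeping for multiples `2^v·s` (`s` odd). Part 2
(`…RTLostBitLaw.lean`) turns this into the exact order `2^(N_x + N_y − (M+1))` of `B(x, y)` for `τx = x`, `τy = −y`.
Memo: `Cruxes/PowDvdShaCardAtTwoRT/Lines/plus-descent-lead-g15.md`.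

References: [McCallumLMS1991] §2, §3 (the ⟨τ⟩-basis of E[p^M]), Prop. 4.4, §5 Lemma 5.3; [GrossLMS1991] Prop. 6.2, §8;
[MilneADT2006] I §2; [SilvermanAEC2009] III.8.1.
-/

set_option autoImplicit false
-- `Summit.<P>.<Sub>` repeats `BirchSwinnertonDyer` by the tree's layout convention (D-0017)
set_option linter.dupNamespace false

namespace Summit.BirchSwinnertonDyer.BirchSwinnertonDyer.Theorems.GenusExact.PlusDescent

/-! ## §1 General identities for a `τ`-anti-invariant bi-additive pairing -/

section General

variable {A R : Type*} [AddCommGroup A] [AddCommGroup R]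
  (τ : A →+ A) (hτ : ∀ x, τ (τ x) = x) (B : A →+ A →+ R) (hanti : ∀ x y, B (τ x) (τ y) = -B x y)
include hτ hanti

/-- Moving `τ` across an anti-invariant pairing: `B(τp, q) = −B(p, τq)`. [folklore] -/
theorem pairing_tau_left (p q : A) : B (τ p) q = -B p (τ q) := by
  have h := hanti p (τ q)
  rwa [hτ] at h

/-- **Same sign, `+`: norms are orthogonal.** `B(p + τp, q + τq) = 0` for an anti-invariant pairing — the `p = 2` form of
«classes in the same eigenspace pair trivially». [cite: McCallumLMS1991, §5 Lemma 5.3 (proof: Gal(K/ℚ)-equivariance)] -/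
theorem pairing_norm_norm_eq_zero (p q : A) : B (p + τ p) (q + τ q) = 0 := by
  simp only [map_add, AddMonoidHom.add_apply]
  rw [pairing_tau_left τ hτ B hanti p q, hanti p q]
  abel

/-- **Same sign, `−`: conorms are orthogonal.** `B(p − τp, q − τq) = 0`. [cite: McCallumLMS1991, §5 Lemma 5.3] -/
theorem pairing_conorm_conorm_eq_zero (p q : A) : B (p - τ p) (q - τ q) = 0 := by
  simp only [map_sub, AddMonoidHom.sub_apply]
  rw [pairing_tau_left τ hτ B hanti p q, hanti p q]
  abel

/-- **Opposite signs: ONE LOST BIT.** `B(p + τp, q − τq) = 2·(B(p,q) − B(p,τq))` — the pairing of a norm with a conorm is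
divisible by `2`. [folklore; cite: McCallumLMS1991, §5 Lemma 5.3 and Prop. 4.4 (the `±` duality whose `p = 2` shadow this is)] -/
theorem pairing_norm_conorm (p q : A) : B (p + τ p) (q - τ q) = 2 • (B p q - B p (τ q)) := by
  simp only [map_add, map_sub, AddMonoidHom.add_apply]
  rw [pairing_tau_left τ hτ B hanti p q, hanti p q, two_nsmul]
  abel

/-- **Opposite signs, the other order.** `B(p − τp, q + τq) = 2·(B(p,q) + B(p,τq))`. [folklore] -/
theorem pairing_conorm_norm (p q : A) : B (p - τ p) (q + τ q) = 2 • (B p q + B p (τ q)) := by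
  simp only [map_add, map_sub, AddMonoidHom.sub_apply]
  rw [pairing_tau_left τ hτ B hanti p q, hanti p q, two_nsmul]
  abel

end General

/-! ## §2 Free rank-one `ℤ/2^M[C₂]`-modules: eigenvectors are (co)norms; orders of multiples -/

section Orders

variable {G : Type*} [AddCommGroup G]

/-- An element of additive order `2^M`, multiplied by `2^v · s` with `s` odd and `v ≤ M`, has order `2^(M − v)`. [folklore] -/
theorem addOrderOf_two_pow_mul_odd_nsmul {g : G} {M : ℕ} (hg : addOrderOf g = 2 ^ M) {v s : ℕ} (hv : v ≤ M)
    (hs : Odd s) : addOrderOf ((2 ^ v * s) • g) = 2 ^ (M - v) := by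
  have h1 : addOrderOf ((2 ^ v) • g) = 2 ^ (M - v) := by
    rw [addOrderOf_nsmul_of_dvd (pow_ne_zero v two_ne_zero) (hg ▸ pow_dvd_pow 2 hv), hg,
      Nat.pow_div hv two_pos]
  have hcop : (addOrderOf ((2 ^ v) • g)).Coprime s := by
    rw [h1]
    exact Nat.Coprime.pow_left _ (Nat.coprime_two_left.mpr hs)
  rw [mul_nsmul, hcop.addOrderOf_nsmul, h1]

/-- If `2^k · s • g = 0`-type vanishing: an element of order `2^M` is killed by `2^v · s` (`s` odd) iff `M ≤ v`. [folklore] -/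
theorem two_pow_mul_odd_nsmul_eq_zero_iff {g : G} {M : ℕ} (hg : addOrderOf g = 2 ^ M) (v s : ℕ) (hs : Odd s) :
    (2 ^ v * s) • g = 0 ↔ M ≤ v := by
  rw [← addOrderOf_dvd_iff_nsmul_eq_zero, hg]
  constructor
  · intro h
    have h2 : 2 ^ M ∣ 2 ^ v :=
      (Nat.Coprime.pow_left M (Nat.coprime_two_left.mpr hs)).dvd_of_dvd_mul_right h
    exact (Nat.pow_dvd_pow_iff_le_right one_lt_two).mp h2
  · intro h
    exact (pow_dvd_pow 2 h).mul_right s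

/-- The exponent of a `2`-power order is determined: `addOrderOf x = 2^a = 2^b ⟹ a = b`. [folklore] -/
theorem eq_of_two_pow_eq_two_pow {a b : ℕ} (h : (2 : ℕ) ^ a = 2 ^ b) : a = b :=
  Nat.pow_right_injective le_rfl h

/-- Reduction of an integer multiple of a `2^M`-torsion element to a natural multiple below `2^M`. [folklore] -/
theorem exists_nat_lt_nsmul_eq_zsmul {g : G} {M : ℕ} (hg : (2 ^ M : ℤ) • g = 0) (a : ℤ) :
    ∃ n : ℕ, n < 2 ^ M ∧ (n : ℤ) • g = a • g := by
  have hm : (0 : ℤ) < (2 : ℤ) ^ M := by positivity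
  refine ⟨(a % (2 : ℤ) ^ M).toNat, ?_, ?_⟩
  · have h := Int.emod_lt_of_pos a hm
    have h0 := Int.emod_nonneg a hm.ne'
    zify
    rw [Int.toNat_of_nonneg h0]
    exact_mod_cast h
  · rw [Int.toNat_of_nonneg (Int.emod_nonneg a hm.ne')]
    conv_rhs => rw [← Int.emod_add_mul_ediv a ((2 : ℤ) ^ M)]
    rw [add_zsmul, mul_comm, mul_zsmul, hg, zsmul_zero, add_zero]

end Orders

section FreeRankOne

variable {A R : Type*} [AddCommGroup A] [AddCommGroup R]
  (τ : A →+ A) (hτ : ∀ x, τ (τ x) = x) {M : ℕ} (P₀ : A)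
  (hspan : ∀ Q : A, ∃ a b : ℤ, Q = a • P₀ + b • τ P₀)
  (hfree : ∀ a b : ℤ, a • P₀ + b • τ P₀ = 0 → (2 ^ M : ℤ) ∣ a ∧ (2 ^ M : ℤ) ∣ b)
  (htor : (2 ^ M : ℤ) • P₀ = 0)

include htor in
/-- In the free module, `2^M · τP₀ = 0` too. [folklore] -/
theorem two_pow_zsmul_tau_eq_zero : (2 ^ M : ℤ) • τ P₀ = 0 := by
  rw [← map_zsmul, htor, map_zero]

include hτ hspan hfree htor in
/-- **`τ`-fixed vectors are norms.** In a free rank-one `ℤ/2^M[C₂]`-module (`E[2^M]` on `Δ < 0`, route item Q1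
`CyclicTorsionOfNegDisc`), `τx = x` forces `x = a·(P₀ + τP₀)`: `H¹(C₂, R_M) = 0`, the `p = 2` substitute for the
`+`-eigenspace. [folklore; cite: McCallumLMS1991, §3 (choice of the ⟨τ⟩-basis of E[p^M])] -/
theorem exists_eq_zsmul_norm_of_tau_eq {x : A} (hx : τ x = x) : ∃ a : ℤ, x = a • (P₀ + τ P₀) := by
  obtain ⟨a, b, rfl⟩ := hspan x
  have hτx : τ (a • P₀ + b • τ P₀) = a • τ P₀ + b • P₀ := by
    rw [map_add, map_zsmul, map_zsmul, hτ]
  -- `x − τx = 0` reads `(a − b)P₀ + (b − a)τP₀ = 0`, so `2^M ∣ b − a`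
  have hrel : (a - b) • P₀ + (b - a) • τ P₀ = 0 := by
    have h : (a • P₀ + b • τ P₀) - τ (a • P₀ + b • τ P₀) = 0 := by rw [hx, sub_self]
    rw [hτx] at h
    rw [← h, sub_zsmul, sub_zsmul]
    abel
  obtain ⟨-, ⟨k, hk⟩⟩ := hfree _ _ hrel
  refine ⟨a, ?_⟩
  have hb : b = a + 2 ^ M * k := by linear_combination hk
  rw [hb, zsmul_add, add_zsmul, mul_comm, mul_zsmul, two_pow_zsmul_tau_eq_zero τ P₀ htor, zsmul_zero, add_zero]

include hτ hspan hfree htor in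
/-- **`τ`-anti-fixed vectors are conorms.** `τy = −y` forces `y = a·(P₀ − τP₀)`. [folklore] -/
theorem exists_eq_zsmul_conorm_of_tau_eq_neg {y : A} (hy : τ y = -y) : ∃ a : ℤ, y = a • (P₀ - τ P₀) := by
  obtain ⟨a, b, rfl⟩ := hspan y
  have hτy : τ (a • P₀ + b • τ P₀) = a • τ P₀ + b • P₀ := by
    rw [map_add, map_zsmul, map_zsmul, hτ]
  -- `y + τy = 0` reads `(a + b)P₀ + (a + b)τP₀ = 0`, so `2^M ∣ a + b`
  have hrel : (a + b) • P₀ + (a + b) • τ P₀ = 0 := by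
    have h : (a • P₀ + b • τ P₀) + τ (a • P₀ + b • τ P₀) = 0 := by rw [hy, add_neg_cancel]
    rw [hτy] at h
    rw [← h, add_zsmul, add_zsmul]
    abel
  obtain ⟨-, ⟨k, hk⟩⟩ := hfree _ _ hrel
  refine ⟨a, ?_⟩
  have hb : b = -a + 2 ^ M * k := by linear_combination hk
  rw [hb, zsmul_sub, add_zsmul, neg_zsmul, mul_comm, mul_zsmul, two_pow_zsmul_tau_eq_zero τ P₀ htor, zsmul_zero,
    add_zero, sub_eq_add_neg]

include hfree htor in
/-- **The norm `P₀ + τP₀` has full order `2^M`.** [folklore] -/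
theorem addOrderOf_norm_eq : addOrderOf (P₀ + τ P₀) = 2 ^ M := by
  apply Nat.dvd_antisymm
  · rw [addOrderOf_dvd_iff_nsmul_eq_zero, ← natCast_zsmul, Nat.cast_pow, Nat.cast_ofNat, zsmul_add, htor,
      two_pow_zsmul_tau_eq_zero τ P₀ htor, add_zero]
  · have h0 : ((addOrderOf (P₀ + τ P₀) : ℕ) : ℤ) • P₀ + ((addOrderOf (P₀ + τ P₀) : ℕ) : ℤ) • τ P₀ = 0 := by
      rw [← zsmul_add, natCast_zsmul, addOrderOf_nsmul_eq_zero]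
    obtain ⟨h, -⟩ := hfree _ _ h0
    exact_mod_cast Int.natCast_dvd_natCast.mp (by exact_mod_cast h)

include hfree htor in
/-- **The conorm `P₀ − τP₀` has full order `2^M`.** [folklore] -/
theorem addOrderOf_conorm_eq : addOrderOf (P₀ - τ P₀) = 2 ^ M := by
  apply Nat.dvd_antisymm
  · rw [addOrderOf_dvd_iff_nsmul_eq_zero, ← natCast_zsmul, Nat.cast_pow, Nat.cast_ofNat, zsmul_sub, htor,
      two_pow_zsmul_tau_eq_zero τ P₀ htor, sub_zero]
  · have h0 : ((addOrderOf (P₀ - τ P₀) : ℕ) : ℤ) • P₀ + (-((addOrderOf (P₀ - τ P₀) : ℕ) : ℤ)) • τ P₀ = 0 := by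
      rw [neg_zsmul, ← sub_eq_add_neg, ← zsmul_sub, natCast_zsmul, addOrderOf_nsmul_eq_zero]
    obtain ⟨h, -⟩ := hfree _ _ h0
    exact_mod_cast Int.natCast_dvd_natCast.mp (by exact_mod_cast h)

/-- **Normal form of a multiple of an element of order `2^M`.** Every integer multiple `a • g` of an element `g` of order `2^M`
is `0` or `(2^v · s) • g` with `s` odd, `v < M`, and then has order `2^(M − v)`. [folklore] -/
theorem zsmul_eq_zero_or_eq_two_pow_mul_odd_nsmul {G : Type*} [AddCommGroup G] {g : G} (hg : addOrderOf g = 2 ^ M) (a : ℤ) :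
    a • g = 0 ∨ ∃ v s : ℕ, v < M ∧ Odd s ∧ a • g = (2 ^ v * s) • g := by
  have hg0 : (2 ^ M : ℤ) • g = 0 := by
    have : ((2 ^ M : ℕ) : ℤ) • g = 0 := by rw [natCast_zsmul, ← hg, addOrderOf_nsmul_eq_zero]
    exact_mod_cast this
  obtain ⟨n, hnlt, hn⟩ := exists_nat_lt_nsmul_eq_zsmul hg0 a
  rcases Nat.eq_zero_or_pos n with rfl | hnpos
  · left
    rw [← hn, Nat.cast_zero, zero_zsmul]
  · right
    obtain ⟨v, s, hs, rfl⟩ := Nat.exists_eq_two_pow_mul_odd hnpos.ne'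
    refine ⟨v, s, ?_, hs, ?_⟩
    · by_contra hv
      push Not at hv
      have : 2 ^ M ≤ 2 ^ v * s := le_trans (Nat.pow_le_pow_right two_pos hv) (Nat.le_mul_of_pos_right _ hs.pos)
      omega
    · rw [← hn, natCast_zsmul]

end FreeRankOne

end Summit.BirchSwinnertonDyer.BirchSwinnertonDyer.Theorems.GenusExact.PlusDescent
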